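import Mathlib

/-!
# Solo-blind kernel #272 — a DECIDABLE disc-cover certificate (boxes ⇒ region)

The [A′]/LEMMA-P assembly certifies `‖L‖ ≤ q < 1` (ENGINE L) on finitely many closed DISCS
`|s − c_k| ≤ r_k` and needs the bound at EVERY point of a rectangle / strip region (ENGINE-L-SPEC §15(p):
the cover certificate, so far a Python check `tools/cover_check.py`).  This file makes the cover step
kernel-checkable:

* `Disc`, `Cell` with RATIONAL data; real point sets `Disc.carrier`, `Cell.carrier ⊆ ℝ × ℝ`;
* `cellInDisc` (Bool): the four vertices of the cell lie in the disc — `cell_subset_disc`: then the whole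
  cell does (convexity of `t ↦ (t − c)²` on a segment: `sq_sub_le_max`);
* `coverOK cells discs` (Bool) and `coverOK_sound` : every point of every cell lies in some disc;
* `mem_segments` : `[x₀, x₀ + n h]` is the union of the `n` segments `[x₀ + i h, x₀ + (i+1) h]`;
  `gridCells` and `rect_covered` : `coverOK (gridCells …) discs = true` ⇒ the rectangle
  `[x₀, x₀ + nₓhₓ] × [y₀, y₀ + n_yh_y]` is covered by the discs;
* `bound_on_rect` : per-disc bounds `f ≤ q` on the discs + the certificate ⇒ `f ≤ q` on the rectangle
  (the form in which box verdicts enter #269 `strip_data_of_plain`).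
A 3-disc toy certificate is checked by `decide` at the end (the production lists are rational:
centres `−12 + (2c′+1)·12/83`, radii `1689/10⁴`, so the same `decide`/kernel evaluation applies).
-/

namespace Summit.AnomalousDissipation.SoloBlind.DiscCover

/-- A closed disc with rational centre and radius. -/
structure Disc where
  /-- centre, real part -/
  cx : ℚ
  /-- centre, imaginary part -/
  cy : ℚ
  /-- radius -/
  r : ℚ

/-- A closed axis-parallel rectangle cell with rational corners. -/
structure Cell where
  /-- left -/
  x0 : ℚ
  /-- right -/
  x1 : ℚ
  /-- bottom -/
  y0 : ℚ
  /-- top -/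
  y1 : ℚ

/-- The disc as a subset of `ℝ × ℝ` (Euclidean closed disc). -/
def Disc.carrier (D : Disc) : Set (ℝ × ℝ) :=
  {p | (p.1 - D.cx) ^ 2 + (p.2 - D.cy) ^ 2 ≤ (D.r : ℝ) ^ 2}

/-- The cell as a subset of `ℝ × ℝ`. -/
def Cell.carrier (c : Cell) : Set (ℝ × ℝ) :=
  {p | (c.x0 : ℝ) ≤ p.1 ∧ p.1 ≤ c.x1 ∧ (c.y0 : ℝ) ≤ p.2 ∧ p.2 ≤ c.y1}

/-- Membership in a disc, unfolded. -/
theorem Disc.mem_carrier {D : Disc} {x y : ℝ} :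
    (x, y) ∈ D.carrier ↔ (x - D.cx) ^ 2 + (y - D.cy) ^ 2 ≤ (D.r : ℝ) ^ 2 := Iff.rfl

/-- Membership in a cell, unfolded. -/
theorem Cell.mem_carrier {c : Cell} {x y : ℝ} :
    (x, y) ∈ c.carrier ↔ (c.x0 : ℝ) ≤ x ∧ x ≤ c.x1 ∧ (c.y0 : ℝ) ≤ y ∧ y ≤ c.y1 := Iff.rfl

/-- Rational vertex test. -/
def vertIn (D : Disc) (x y : ℚ) : Bool := decide ((x - D.cx) ^ 2 + (y - D.cy) ^ 2 ≤ D.r ^ 2)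

/-- All four vertices of the cell lie in the disc. -/
def cellInDisc (c : Cell) (D : Disc) : Bool :=
  vertIn D c.x0 c.y0 && vertIn D c.x0 c.y1 && vertIn D c.x1 c.y0 && vertIn D c.x1 c.y1

/-- The cover certificate: every cell lies (by its vertices) in some disc. -/
def coverOK (cells : List Cell) (discs : List Disc) : Bool :=
  cells.all fun c => discs.any fun D => cellInDisc c D

/-- `vertIn` is sound over `ℝ`. -/
theorem vertIn_sound {D : Disc} {x y : ℚ} (h : vertIn D x y = true) :
    ((x : ℝ), (y : ℝ)) ∈ D.carrier := by
  unfold vertIn at h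
  have h' : (x - D.cx) ^ 2 + (y - D.cy) ^ 2 ≤ D.r ^ 2 := of_decide_eq_true h
  rw [Disc.mem_carrier]
  exact_mod_cast h'

/-- Convexity of the square on a segment: for `a ≤ t ≤ b`, `(t − c)² ≤ max ((a − c)², (b − c)²)`. -/
theorem sq_sub_le_max {a b t c : ℝ} (ha : a ≤ t) (hb : t ≤ b) :
    (t - c) ^ 2 ≤ max ((a - c) ^ 2) ((b - c) ^ 2) := by
  have h := abs_le_max_abs_abs (sub_le_sub_right ha c) (sub_le_sub_right hb c)
  rcases le_max_iff.1 h with h1 | h1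
  · exact le_max_of_le_left (by rw [← sq_abs (t - c), ← sq_abs (a - c)]; gcongr)
  · exact le_max_of_le_right (by rw [← sq_abs (t - c), ← sq_abs (b - c)]; gcongr)

/-- **A cell whose four vertices lie in a disc lies in the disc.** -/
theorem cell_subset_disc {c : Cell} {D : Disc} (h : cellInDisc c D = true) {x y : ℝ}
    (hxy : (x, y) ∈ c.carrier) : (x, y) ∈ D.carrier := by
  unfold cellInDisc at h
  simp only [Bool.and_eq_true] at h
  obtain ⟨⟨⟨h00, h01⟩, h10⟩, h11⟩ := h
  have m00 := vertIn_sound h00; have m01 := vertIn_sound h01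
  have m10 := vertIn_sound h10; have m11 := vertIn_sound h11
  rw [Disc.mem_carrier] at *
  obtain ⟨hx0, hx1, hy0, hy1⟩ := Cell.mem_carrier.1 hxy
  have hx := sq_sub_le_max (c := (D.cx : ℝ)) hx0 hx1
  have hy := sq_sub_le_max (c := (D.cy : ℝ)) hy0 hy1
  rcases le_max_iff.1 hx with hx' | hx' <;> rcases le_max_iff.1 hy with hy' | hy' <;> linarith

/-- **Soundness of the certificate**: every point of every listed cell lies in some listed disc. -/
theorem coverOK_sound {cells : List Cell} {discs : List Disc} (h : coverOK cells discs = true)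
    {c : Cell} (hc : c ∈ cells) {x y : ℝ} (hxy : (x, y) ∈ c.carrier) :
    ∃ D ∈ discs, (x, y) ∈ D.carrier := by
  unfold coverOK at h
  rw [List.all_eq_true] at h
  have hc' := h c hc
  rw [List.any_eq_true] at hc'
  obtain ⟨D, hD, hcD⟩ := hc'
  exact ⟨D, hD, cell_subset_disc hcD hxy⟩

/-- Segment decomposition: a point of `[x₀, x₀ + n h]` (`n ≥ 1`) lies in some
`[x₀ + i h, x₀ + (i+1) h]`, `i < n`. -/
theorem mem_segments {x₀ h x : ℝ} :
    ∀ n : ℕ, 0 < n → x₀ ≤ x → x ≤ x₀ + n * h →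
      ∃ i : ℕ, i < n ∧ x₀ + i * h ≤ x ∧ x ≤ x₀ + (i + 1) * h := by
  intro n
  induction n with
  | zero => intro h0; exact absurd h0 (lt_irrefl 0)
  | succ m ih =>
    intro _ hlo hhi
    by_cases hm : m = 0
    · subst hm
      refine ⟨0, Nat.zero_lt_one, by simpa using hlo, by simpa using hhi⟩
    · by_cases hcut : x ≤ x₀ + m * h
      · obtain ⟨i, hi, h1, h2⟩ := ih (Nat.pos_of_ne_zero hm) hlo hcut
        exact ⟨i, Nat.lt_succ_of_lt hi, h1, h2⟩
      · push Not at hcut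
        refine ⟨m, Nat.lt_succ_self m, hcut.le, ?_⟩
        simpa [Nat.cast_succ] using hhi

/-- The grid cells of `[x₀, x₀ + nₓ hₓ] × [y₀, y₀ + n_y h_y]`. -/
def gridCells (x₀ y₀ hx hy : ℚ) (nx ny : ℕ) : List Cell :=
  (List.range nx).flatMap fun i : ℕ => (List.range ny).map fun j : ℕ =>
    { x0 := x₀ + (i : ℚ) * hx, x1 := x₀ + ((i : ℚ) + 1) * hx,
      y0 := y₀ + (j : ℚ) * hy, y1 := y₀ + ((j : ℚ) + 1) * hy }

/-- Membership of the `(i,j)` grid cell in `gridCells`. -/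
theorem mem_gridCells {x₀ y₀ hx hy : ℚ} {nx ny i j : ℕ} (hi : i < nx) (hj : j < ny) :
    ({ x0 := x₀ + (i : ℚ) * hx, x1 := x₀ + ((i : ℚ) + 1) * hx,
       y0 := y₀ + (j : ℚ) * hy, y1 := y₀ + ((j : ℚ) + 1) * hy } : Cell)
      ∈ gridCells x₀ y₀ hx hy nx ny := by
  unfold gridCells
  rw [List.mem_flatMap]
  exact ⟨i, List.mem_range.2 hi, List.mem_map.2 ⟨j, List.mem_range.2 hj, rfl⟩⟩

/-- **Rectangle covered**: if the grid certificate passes, every point of the rectangle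
`[x₀, x₀ + nₓhₓ] × [y₀, y₀ + n_yh_y]` lies in some disc. -/
theorem rect_covered {x₀ y₀ hx hy : ℚ} {nx ny : ℕ} {discs : List Disc}
    (hcert : coverOK (gridCells x₀ y₀ hx hy nx ny) discs = true) (hnx : 0 < nx) (hny : 0 < ny)
    {x y : ℝ} (hx0 : (x₀ : ℝ) ≤ x) (hx1 : x ≤ x₀ + nx * hx)
    (hy0 : (y₀ : ℝ) ≤ y) (hy1 : y ≤ y₀ + ny * hy) : ∃ D ∈ discs, (x, y) ∈ D.carrier := by
  obtain ⟨i, hi, hxi0, hxi1⟩ :=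
    mem_segments (x₀ := (x₀ : ℝ)) (h := (hx : ℝ)) (x := x) nx hnx hx0 hx1
  obtain ⟨j, hj, hyj0, hyj1⟩ :=
    mem_segments (x₀ := (y₀ : ℝ)) (h := (hy : ℝ)) (x := y) ny hny hy0 hy1
  refine coverOK_sound hcert (mem_gridCells hi hj) (Cell.mem_carrier.2 ?_)
  refine ⟨?_, ?_, ?_, ?_⟩ <;> push_cast <;> linarith

/-- **Box verdicts ⇒ region bound.**  If `f ≤ q` on every listed disc and the grid certificate passes,
then `f ≤ q` on the whole rectangle. -/
theorem bound_on_rect {x₀ y₀ hx hy : ℚ} {nx ny : ℕ} {discs : List Disc} {f : ℝ → ℝ → ℝ} {q : ℝ}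
    (hcert : coverOK (gridCells x₀ y₀ hx hy nx ny) discs = true) (hnx : 0 < nx) (hny : 0 < ny)
    (hbox : ∀ D ∈ discs, ∀ x y : ℝ, (x, y) ∈ D.carrier → f x y ≤ q)
    {x y : ℝ} (hx0 : (x₀ : ℝ) ≤ x) (hx1 : x ≤ x₀ + nx * hx) (hy0 : (y₀ : ℝ) ≤ y)
    (hy1 : y ≤ y₀ + ny * hy) : f x y ≤ q := by
  obtain ⟨D, hD, hm⟩ := rect_covered hcert hnx hny hx0 hx1 hy0 hy1
  exact hbox D hD x y hm

/-- Toy certificate (3 discs of radius `1689/10⁴` at the X3 spacing `2hₓ`, `hₓ = 12/83`, on the row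
`y_c = −16313/10⁵` cover the band `|y − y_c| ≤ 873/10⁴` over their three columns), checked by
evaluation of the rational vertex tests. -/
example :
    coverOK (gridCells 0 (-16313/100000 - 873/10000) (24/83) (873/5000) 3 1)
      [⟨12/83, -16313/100000, 1689/10000⟩, ⟨36/83, -16313/100000, 1689/10000⟩,
       ⟨60/83, -16313/100000, 1689/10000⟩] = true := by
  simp only [coverOK, gridCells, cellInDisc, vertIn, List.range, List.range.loop, List.flatMap_cons,
    List.flatMap_nil, List.map_cons, List.map_nil, List.cons_append, List.nil_append, List.all_cons,
    List.all_nil, List.any_cons, List.any_nil, Bool.and_true, Bool.or_false, Bool.and_eq_true,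
    Bool.or_eq_true, decide_eq_true_eq]
  norm_num

end Summit.AnomalousDissipation.SoloBlind.DiscCover
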